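import Literature.MathematicalPhysics.QuantumFieldTheory.Balaban1983to89.B11Thm1ExistsUniqueTokensGBBridges
import Literature.MathematicalPhysics.QuantumFieldTheory.Balaban1983to89.Node00.CriticalOnFibreTopGuardedBPrint

/-!
# `Balaban1983to89.B11Thm1ExistsUniqueTokensGBPrint` — [Balaban1985Variational] = «[15]», Theorem 1 (7)–(8) pp. 278–279: THE (E∕U) NAME, THE STEP AND SUPPLY TOKENS AND K0's (R)-NAME OVER
# `(bd, Dat)` ARE ANTITONE IN THE DATA PREDICATE **UNDER THE GUARD**, AND THE PRINT PLUG: a token produced at print's top-domain (7) `Node00.dataSmall7LamTopOf F N` (the [II] (2.3)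
# ranges, one-deep-corner plaquettes out — §7′ `Node00/Record12BgRowMixedDataB`) SERVES the same token at the record's (7) `Node00.dataSmall7PTopOf F N` whenever the guard carries the
# standing range `k ≤ m + K` and the block saturation of the index (THEOREMS ONLY; the `(E∕U)` companion of dag-n07-e's `Node00/CriticalOnFibreTopGuardedBPrint` §2 for the Prop-8 tokens)

Honest framing: statement-level skeleton of published theorems with citation tags; proofs where landed; nothing here is a claim about the Yang–Mills mass gap.  Cell `pub-ymgap`
(HUMAN RULINGS D-0062 ∕ D-0149), lane `pub-ymgap-dag-n12-c` g34 (R134 seat (a), N12 = [B15], s1); `--kind proof --supports` K1⁹ `stmt-QuantumFields-27364`; count-neutral; N12 NOT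
discharged; finite 𝕋⁴ at fixed ε; nothing continuum ∕ ℝ⁴ ∕ OS ∕ mass-gap ∕ Clay.  THEOREMS ONLY (0 `def`, 0 `instance`, 0 `sorry`): binder threading between named `Prop`s, none asserted.

WHY.  After Stage 3 the K0 road produces its tokens at PRINT's instance `(Node00.lamDatum F, Node00.dataSmall7LamTopOf F N)`; N12's Proposition-1 road proves the record's (7)
`Node00.dataSmall7PTopOf` for its data `M˙(Q_k^{s*}V_k)` along `Z`'s maximal sequence (`B15Prop1DatumSmall7AtZSequence.dataSmall7PTop_avgFamily_qsstarGIter0`), which IMPLIES print's (7)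
(`Sect2.DataSmall7PTop.toLamTop`, side conditions `k ≤ m + K`, `Ω (k+1) = ∅`, saturation).  A token whose data hypothesis is the WEAKER print (7) is the STRONGER token; so the K0 product at
print's datum serves every N12 head stated with the record's (7) at the SAME bond datum `bd` — through the guarded antitonicity below, the side conditions read off the guard (K0's grid
guard `A‴(c,c₀,c₁)` carries `k + c₀ ≤ m + K` and the cube divisibility that gives saturation; displayed here as a hypothesis on an arbitrary `Adm`).

CONTENTS.
* §1 GUARDED `.of_imp_dat`: `VariationalThm1EUSepTop7MGB.of_imp_dat_adm` ∕ `…CoP7MGB…`, `VariationalThm1EUStepTop7MGB.of_imp_dat_adm` ∕ `…CoP…`, `ApproxMinimiserExistsTop7MGB.of_imp_dat_adm` ∕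
  `…CoP…` (the implication `Dat′ → Dat` may use `ν M g K k s`, the guard and `0 < k`), and `variationalThm1RegSepTop7MGB_of_imp_dat_adm` ∕ `…CoP7MGB…` for K0's S1a-C (R)-name (plain
  names in THIS namespace; `Node00.VariationalThm1RegSepTop7MGB.of_imp_dat` is the unguarded one of record).
* §2 THE PRINT PLUG at any bond datum `bd`: `VariationalThm1EUSepTop7MGB.pTop_of_lamTop` ∕ `…CoP…`, `VariationalThm1EUStepTop7MGB.pTop_of_lamTop` ∕ `…CoP…`,
  `ApproxMinimiserExistsTop7MGB.pTop_of_lamTop` ∕ `…CoP…`, `variationalThm1RegSepTop7MGB_pTop_of_lamTop` ∕ `…CoP…` — from the token at `(bd, dataSmall7LamTopOf F N)` to the token at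
  `(bd, dataSmall7PTopOf F N)` under a guard implying `k ≤ m + K` and the block saturation of `s.Ω j` (`1 ≤ j ≤ k`), by dag-n07-e's `Node00.dataSmall7LamTopOf_of_seq`.
NOT HERE: the LIFT token (its data predicate sits on both sides of the implication — truncated and full problem — so it is not antitone in `Dat` alone).

HONEST SCOPE.  Binder threading; nothing of Bałaban's analysis asserted or proved; no token inhabited; count-neutral; K0⁷ ∕ K1⁹ NOT closed; N12 NOT discharged; the Yang–Mills mass gap (Clay)
is NOT proved by any of this.

References: [15] (3),(7) p.278, Thm 1 (8) p.279, (14) p.280, Prop. 2 p.281; [II] = [Balaban1984PropagatorsII] (2.3) p.224; [III] = [Balaban1988Convergent] (2.1) p.254, (2.12) p.256,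
(2.18) p.257; [6] = [Balaban1985RegularSpaces] (1.3)–(1.9) p.77.
-/

noncomputable section

namespace Literature.MathematicalPhysics.QuantumFieldTheory.Balaban1983to89.B11Thm1ExistsUniqueTokensGB

open T4Continuum B15DeterminingSets B15DeterminingSetsB GaugeField Node00
open B5Eq118OneStroke (iterBlockOf)

variable {F : T4Family} {N : ℕ} [NeZero N]
variable {Sup : (ν : Stage7Numerics) → (K : ℕ) → (ℕ → Set (Site (F.P K) 0)) → Set (Site (F.P K) 0)} {Adm : StepGuard F} {bd : BondDatum F} {Dat Dat' : TopData F N}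
  {C₁ B₃ a₀ a₁ : ℝ}

/-! ## §1  Antitone in the data predicate under the guard -/

section Guarded

/-- ★ GUARDED `.of_imp_dat` for the (E∕U) name: a data hypothesis `Dat′` implying `Dat` AT THE RUN's PREFIX (the implication may use `ν M g K k s`, the guard and `0 < k`) gives the name at
`Dat′` from the name at `Dat`. [cite: Balaban1985Variational, (7) p.278, Thm 1 p.279 (bookkeeping)] -/
theorem VariationalThm1EUSepTop7MGB.of_imp_dat_adm (h : VariationalThm1EUSepTop7MGB F N Sup Adm bd Dat B₃ a₀ a₁)
    (himp : ∀ (ν : Stage7Numerics) (M : ℕ) (g : ℕ → ℝ) (K k : ℕ) (s : SeqOfRecord F ν M g K k), Adm ν M g K k s → 0 < k →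
      ∀ (δ : ℕ → ℝ) (W : MSField (F.P K) (SU N)), Dat' K s.Ω (Sup ν K s.Ω) k δ W → Dat K s.Ω (Sup ν K s.Ω) k δ W) :
    VariationalThm1EUSepTop7MGB F N Sup Adm bd Dat' B₃ a₀ a₁ :=
  fun ν M g K k s hk hsep hM₁ hadm ε₀ δ hnum hc hc' hε W h7 => h ν M g K k s hk hsep hM₁ hadm ε₀ δ hnum hc hc' hε W (himp ν M g K k s hadm hk δ W h7)

/-- `CoP` edition of the guarded `.of_imp_dat` for the (E∕U) name. [cite: Balaban1985Variational, (7) p.278, Thm 1 p.279 (bookkeeping)] -/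
theorem VariationalThm1EUSepCoP7MGB.of_imp_dat_adm (h : VariationalThm1EUSepCoP7MGB F N Adm bd Dat B₃ a₀ a₁)
    (himp : ∀ (ν : Stage7Numerics) (M : ℕ) (g : ℕ → ℝ) (K k : ℕ) (s : SeqOfRecord F ν M g K k), Adm ν M g K k s → 0 < k →
      ∀ (δ : ℕ → ℝ) (W : MSField (F.P K) (SU N)), Dat' K s.Ω (suppDomOfRecord F ν K s.Ω) k δ W → Dat K s.Ω (suppDomOfRecord F ν K s.Ω) k δ W) :
    VariationalThm1EUSepCoP7MGB F N Adm bd Dat' B₃ a₀ a₁ :=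
  VariationalThm1EUSepTop7MGB.of_imp_dat_adm h himp

/-- ★ GUARDED `.of_imp_dat` for the one-length step token. [cite: Balaban1985Variational, (7) p.278, Prop. 2 p.281 (bookkeeping)] -/
theorem VariationalThm1EUStepTop7MGB.of_imp_dat_adm (h : VariationalThm1EUStepTop7MGB F N Sup Adm bd Dat C₁ B₃ a₀ a₁)
    (himp : ∀ (ν : Stage7Numerics) (M : ℕ) (g : ℕ → ℝ) (K k : ℕ) (s : SeqOfRecord F ν M g K k), Adm ν M g K k s → 0 < k →
      ∀ (δ : ℕ → ℝ) (W : MSField (F.P K) (SU N)), Dat' K s.Ω (Sup ν K s.Ω) k δ W → Dat K s.Ω (Sup ν K s.Ω) k δ W) :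
    VariationalThm1EUStepTop7MGB F N Sup Adm bd Dat' C₁ B₃ a₀ a₁ :=
  fun ν M g K k s hk hsep hM₁ hadm ε₀ δ hnum hc hc' hε W h7 => h ν M g K k s hk hsep hM₁ hadm ε₀ δ hnum hc hc' hε W (himp ν M g K k s hadm hk δ W h7)

/-- `CoP` edition of the guarded `.of_imp_dat` for the step token. [cite: Balaban1985Variational, (7) p.278, Prop. 2 p.281 (bookkeeping)] -/
theorem VariationalThm1EUStepCoP7MGB.of_imp_dat_adm (h : VariationalThm1EUStepCoP7MGB F N Adm bd Dat C₁ B₃ a₀ a₁)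
    (himp : ∀ (ν : Stage7Numerics) (M : ℕ) (g : ℕ → ℝ) (K k : ℕ) (s : SeqOfRecord F ν M g K k), Adm ν M g K k s → 0 < k →
      ∀ (δ : ℕ → ℝ) (W : MSField (F.P K) (SU N)), Dat' K s.Ω (suppDomOfRecord F ν K s.Ω) k δ W → Dat K s.Ω (suppDomOfRecord F ν K s.Ω) k δ W) :
    VariationalThm1EUStepCoP7MGB F N Adm bd Dat' C₁ B₃ a₀ a₁ :=
  VariationalThm1EUStepTop7MGB.of_imp_dat_adm h himp

/-- ★ GUARDED `.of_imp_dat` for the supply token. [cite: Balaban1985Variational, (7) p.278, (14) p.280 (bookkeeping)] -/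
theorem ApproxMinimiserExistsTop7MGB.of_imp_dat_adm (h : ApproxMinimiserExistsTop7MGB F N Sup Adm bd Dat C₁ B₃ a₀ a₁)
    (himp : ∀ (ν : Stage7Numerics) (M : ℕ) (g : ℕ → ℝ) (K k : ℕ) (s : SeqOfRecord F ν M g K k), Adm ν M g K k s → 0 < k →
      ∀ (δ : ℕ → ℝ) (W : MSField (F.P K) (SU N)), Dat' K s.Ω (Sup ν K s.Ω) k δ W → Dat K s.Ω (Sup ν K s.Ω) k δ W) :
    ApproxMinimiserExistsTop7MGB F N Sup Adm bd Dat' C₁ B₃ a₀ a₁ :=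
  fun ν M g K k s hk hsep hM₁ hadm ε₀ δ hnum hc hc' hε W h7 => h ν M g K k s hk hsep hM₁ hadm ε₀ δ hnum hc hc' hε W (himp ν M g K k s hadm hk δ W h7)

/-- `CoP` edition of the guarded `.of_imp_dat` for the supply token. [cite: Balaban1985Variational, (7) p.278, (14) p.280 (bookkeeping)] -/
theorem ApproxMinimiserExistsCoP7MGB.of_imp_dat_adm (h : ApproxMinimiserExistsCoP7MGB F N Adm bd Dat C₁ B₃ a₀ a₁)
    (himp : ∀ (ν : Stage7Numerics) (M : ℕ) (g : ℕ → ℝ) (K k : ℕ) (s : SeqOfRecord F ν M g K k), Adm ν M g K k s → 0 < k →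
      ∀ (δ : ℕ → ℝ) (W : MSField (F.P K) (SU N)), Dat' K s.Ω (suppDomOfRecord F ν K s.Ω) k δ W → Dat K s.Ω (suppDomOfRecord F ν K s.Ω) k δ W) :
    ApproxMinimiserExistsCoP7MGB F N Adm bd Dat' C₁ B₃ a₀ a₁ :=
  ApproxMinimiserExistsTop7MGB.of_imp_dat_adm h himp

/-- ★ GUARDED `.of_imp_dat` for K0's S1a-C (R)-name `Node00.VariationalThm1RegSepTop7MGB` (no length guard in that name, so the implication may use the guard only; the unguarded edition of record is
`Node00.VariationalThm1RegSepTop7MGB.of_imp_dat`). [cite: Balaban1985Variational, (7) p.278, Thm 1 (8) p.279 (bookkeeping)] -/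
theorem variationalThm1RegSepTop7MGB_of_imp_dat_adm (h : VariationalThm1RegSepTop7MGB F N Sup Adm bd Dat B₃ a₀ a₁)
    (himp : ∀ (ν : Stage7Numerics) (M : ℕ) (g : ℕ → ℝ) (K k : ℕ) (s : SeqOfRecord F ν M g K k), Adm ν M g K k s →
      ∀ (δ : ℕ → ℝ) (W : MSField (F.P K) (SU N)), Dat' K s.Ω (Sup ν K s.Ω) k δ W → Dat K s.Ω (Sup ν K s.Ω) k δ W) :
    VariationalThm1RegSepTop7MGB F N Sup Adm bd Dat' B₃ a₀ a₁ :=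
  fun ν M g K k s hsep hM₁ hadm ε₀ δ hnum hc hc' hε W h7 => h ν M g K k s hsep hM₁ hadm ε₀ δ hnum hc hc' hε W (himp ν M g K k s hadm δ W h7)

/-- `CoP` edition of the guarded `.of_imp_dat` for K0's (R)-name. [cite: Balaban1985Variational, (7) p.278, Thm 1 (8) p.279 (bookkeeping)] -/
theorem variationalThm1RegSepCoP7MGB_of_imp_dat_adm (h : VariationalThm1RegSepCoP7MGB F N Adm bd Dat B₃ a₀ a₁)
    (himp : ∀ (ν : Stage7Numerics) (M : ℕ) (g : ℕ → ℝ) (K k : ℕ) (s : SeqOfRecord F ν M g K k), Adm ν M g K k s →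
      ∀ (δ : ℕ → ℝ) (W : MSField (F.P K) (SU N)), Dat' K s.Ω (suppDomOfRecord F ν K s.Ω) k δ W → Dat K s.Ω (suppDomOfRecord F ν K s.Ω) k δ W) :
    VariationalThm1RegSepCoP7MGB F N Adm bd Dat' B₃ a₀ a₁ :=
  variationalThm1RegSepTop7MGB_of_imp_dat_adm h himp

end Guarded

/-! ## §2  The print plug: a token at print's (7) `dataSmall7LamTopOf` serves the token at the record's (7) `dataSmall7PTopOf`, same bond datum -/

section PrintPlug

/-- **THE (E∕U) NAME AT PRINT's (7) SERVES THE (E∕U) NAME AT THE RECORD's (7)** (same `Sup`, guard, bond datum, letters), whenever the guard carries the standing range `k ≤ m + K` and the block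
saturation of the index's regions `Ω_j`, `1 ≤ j ≤ k` (dag-n07-e's `Node00.dataSmall7LamTopOf_of_seq`: the record's (7) implies print's). [cite: Balaban1985Variational, (3),(7) p.278, Thm 1 p.279; Balaban1984PropagatorsII, (2.3) p.224; Balaban1988Convergent, (2.1) p.254, (2.18) p.257] -/
theorem VariationalThm1EUSepTop7MGB.pTop_of_lamTop (h : VariationalThm1EUSepTop7MGB F N Sup Adm bd (dataSmall7LamTopOf F N) B₃ a₀ a₁)
    (hAdm : ∀ (ν : Stage7Numerics) (M : ℕ) (g : ℕ → ℝ) (K k : ℕ) (s : SeqOfRecord F ν M g K k), Adm ν M g K k s →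
      k ≤ (F.P K).m + (F.P K).K ∧ ∀ (j : ℕ) (x x' : Site (F.P K) 0), 1 ≤ j → j ≤ k → iterBlockOf j x = iterBlockOf j x' → x ∈ s.Ω j → x' ∈ s.Ω j) :
    VariationalThm1EUSepTop7MGB F N Sup Adm bd (dataSmall7PTopOf F N) B₃ a₀ a₁ :=
  h.of_imp_dat_adm fun ν M g K k s hadm _ _ _ h7 => dataSmall7LamTopOf_of_seq s (hAdm ν M g K k s hadm).1 (hAdm ν M g K k s hadm).2 h7

/-- `CoP` edition of the print plug for the (E∕U) name. [cite: Balaban1985Variational, (7) p.278, Thm 1 p.279; Balaban1984PropagatorsII, (2.3) p.224] -/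
theorem VariationalThm1EUSepCoP7MGB.pTop_of_lamTop (h : VariationalThm1EUSepCoP7MGB F N Adm bd (dataSmall7LamTopOf F N) B₃ a₀ a₁)
    (hAdm : ∀ (ν : Stage7Numerics) (M : ℕ) (g : ℕ → ℝ) (K k : ℕ) (s : SeqOfRecord F ν M g K k), Adm ν M g K k s →
      k ≤ (F.P K).m + (F.P K).K ∧ ∀ (j : ℕ) (x x' : Site (F.P K) 0), 1 ≤ j → j ≤ k → iterBlockOf j x = iterBlockOf j x' → x ∈ s.Ω j → x' ∈ s.Ω j) :
    VariationalThm1EUSepCoP7MGB F N Adm bd (dataSmall7PTopOf F N) B₃ a₀ a₁ :=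
  VariationalThm1EUSepTop7MGB.pTop_of_lamTop h hAdm

/-- The print plug for the one-length step token. [cite: Balaban1985Variational, (7) p.278, Prop. 2 p.281; Balaban1984PropagatorsII, (2.3) p.224] -/
theorem VariationalThm1EUStepTop7MGB.pTop_of_lamTop (h : VariationalThm1EUStepTop7MGB F N Sup Adm bd (dataSmall7LamTopOf F N) C₁ B₃ a₀ a₁)
    (hAdm : ∀ (ν : Stage7Numerics) (M : ℕ) (g : ℕ → ℝ) (K k : ℕ) (s : SeqOfRecord F ν M g K k), Adm ν M g K k s →
      k ≤ (F.P K).m + (F.P K).K ∧ ∀ (j : ℕ) (x x' : Site (F.P K) 0), 1 ≤ j → j ≤ k → iterBlockOf j x = iterBlockOf j x' → x ∈ s.Ω j → x' ∈ s.Ω j) :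
    VariationalThm1EUStepTop7MGB F N Sup Adm bd (dataSmall7PTopOf F N) C₁ B₃ a₀ a₁ :=
  h.of_imp_dat_adm fun ν M g K k s hadm _ _ _ h7 => dataSmall7LamTopOf_of_seq s (hAdm ν M g K k s hadm).1 (hAdm ν M g K k s hadm).2 h7

/-- `CoP` edition of the print plug for the step token. [cite: Balaban1985Variational, (7) p.278, Prop. 2 p.281; Balaban1984PropagatorsII, (2.3) p.224] -/
theorem VariationalThm1EUStepCoP7MGB.pTop_of_lamTop (h : VariationalThm1EUStepCoP7MGB F N Adm bd (dataSmall7LamTopOf F N) C₁ B₃ a₀ a₁)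
    (hAdm : ∀ (ν : Stage7Numerics) (M : ℕ) (g : ℕ → ℝ) (K k : ℕ) (s : SeqOfRecord F ν M g K k), Adm ν M g K k s →
      k ≤ (F.P K).m + (F.P K).K ∧ ∀ (j : ℕ) (x x' : Site (F.P K) 0), 1 ≤ j → j ≤ k → iterBlockOf j x = iterBlockOf j x' → x ∈ s.Ω j → x' ∈ s.Ω j) :
    VariationalThm1EUStepCoP7MGB F N Adm bd (dataSmall7PTopOf F N) C₁ B₃ a₀ a₁ :=
  VariationalThm1EUStepTop7MGB.pTop_of_lamTop h hAdm

/-- The print plug for the supply token. [cite: Balaban1985Variational, (7) p.278, (14) p.280; Balaban1984PropagatorsII, (2.3) p.224] -/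
theorem ApproxMinimiserExistsTop7MGB.pTop_of_lamTop (h : ApproxMinimiserExistsTop7MGB F N Sup Adm bd (dataSmall7LamTopOf F N) C₁ B₃ a₀ a₁)
    (hAdm : ∀ (ν : Stage7Numerics) (M : ℕ) (g : ℕ → ℝ) (K k : ℕ) (s : SeqOfRecord F ν M g K k), Adm ν M g K k s →
      k ≤ (F.P K).m + (F.P K).K ∧ ∀ (j : ℕ) (x x' : Site (F.P K) 0), 1 ≤ j → j ≤ k → iterBlockOf j x = iterBlockOf j x' → x ∈ s.Ω j → x' ∈ s.Ω j) :
    ApproxMinimiserExistsTop7MGB F N Sup Adm bd (dataSmall7PTopOf F N) C₁ B₃ a₀ a₁ :=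
  h.of_imp_dat_adm fun ν M g K k s hadm _ _ _ h7 => dataSmall7LamTopOf_of_seq s (hAdm ν M g K k s hadm).1 (hAdm ν M g K k s hadm).2 h7

/-- `CoP` edition of the print plug for the supply token. [cite: Balaban1985Variational, (7) p.278, (14) p.280; Balaban1984PropagatorsII, (2.3) p.224] -/
theorem ApproxMinimiserExistsCoP7MGB.pTop_of_lamTop (h : ApproxMinimiserExistsCoP7MGB F N Adm bd (dataSmall7LamTopOf F N) C₁ B₃ a₀ a₁)
    (hAdm : ∀ (ν : Stage7Numerics) (M : ℕ) (g : ℕ → ℝ) (K k : ℕ) (s : SeqOfRecord F ν M g K k), Adm ν M g K k s →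
      k ≤ (F.P K).m + (F.P K).K ∧ ∀ (j : ℕ) (x x' : Site (F.P K) 0), 1 ≤ j → j ≤ k → iterBlockOf j x = iterBlockOf j x' → x ∈ s.Ω j → x' ∈ s.Ω j) :
    ApproxMinimiserExistsCoP7MGB F N Adm bd (dataSmall7PTopOf F N) C₁ B₃ a₀ a₁ :=
  ApproxMinimiserExistsTop7MGB.pTop_of_lamTop h hAdm

/-- **K0's (R)-NAME AT PRINT's (7) SERVES THE (R)-NAME AT THE RECORD's (7)** (same bond datum) — the form N12's record-keyed heads (`B15Prop1MinimiserClassAtDatumScaleAtLength` and its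
siblings, stated with `Sect2.DataSmall7PTop`) consume, once K0 produces `VariationalThm1RegSepCoP7MGB F N A‴ (lamDatum F) (dataSmall7LamTopOf F N) …`.
[cite: Balaban1985Variational, (3),(7) p.278, Thm 1 (8) p.279; Balaban1984PropagatorsII, (2.3) p.224; Balaban1988Convergent, (2.1) p.254, (2.18) p.257] -/
theorem variationalThm1RegSepTop7MGB_pTop_of_lamTop (h : VariationalThm1RegSepTop7MGB F N Sup Adm bd (dataSmall7LamTopOf F N) B₃ a₀ a₁)
    (hAdm : ∀ (ν : Stage7Numerics) (M : ℕ) (g : ℕ → ℝ) (K k : ℕ) (s : SeqOfRecord F ν M g K k), Adm ν M g K k s →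
      k ≤ (F.P K).m + (F.P K).K ∧ ∀ (j : ℕ) (x x' : Site (F.P K) 0), 1 ≤ j → j ≤ k → iterBlockOf j x = iterBlockOf j x' → x ∈ s.Ω j → x' ∈ s.Ω j) :
    VariationalThm1RegSepTop7MGB F N Sup Adm bd (dataSmall7PTopOf F N) B₃ a₀ a₁ :=
  variationalThm1RegSepTop7MGB_of_imp_dat_adm h fun ν M g K k s hadm _ _ h7 => dataSmall7LamTopOf_of_seq s (hAdm ν M g K k s hadm).1 (hAdm ν M g K k s hadm).2 h7

/-- `CoP` edition of the print plug for K0's (R)-name. [cite: Balaban1985Variational, (7) p.278, Thm 1 (8) p.279; Balaban1984PropagatorsII, (2.3) p.224] -/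
theorem variationalThm1RegSepCoP7MGB_pTop_of_lamTop (h : VariationalThm1RegSepCoP7MGB F N Adm bd (dataSmall7LamTopOf F N) B₃ a₀ a₁)
    (hAdm : ∀ (ν : Stage7Numerics) (M : ℕ) (g : ℕ → ℝ) (K k : ℕ) (s : SeqOfRecord F ν M g K k), Adm ν M g K k s →
      k ≤ (F.P K).m + (F.P K).K ∧ ∀ (j : ℕ) (x x' : Site (F.P K) 0), 1 ≤ j → j ≤ k → iterBlockOf j x = iterBlockOf j x' → x ∈ s.Ω j → x' ∈ s.Ω j) :
    VariationalThm1RegSepCoP7MGB F N Adm bd (dataSmall7PTopOf F N) B₃ a₀ a₁ :=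
  variationalThm1RegSepTop7MGB_pTop_of_lamTop h hAdm

end PrintPlug

end Literature.MathematicalPhysics.QuantumFieldTheory.Balaban1983to89.B11Thm1ExistsUniqueTokensGB

end
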